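import Literature.NumberTheory.LFunctions.RiemannXiFourier
import HarnessLib

/-!
# RiemannHypothesis / WeilGroundState — super-exponential decay of Riemann's kernel `Ψ`

Route `RiemannHypothesis/WeilGroundState`, crux item stmt-RiemannHypothesis-1527
(`GroundStatesConvergeToXi`), line `Sketch`, stub `stub_psiDecay` (helper file, `--supports`).

**Statement.** Riemann's kernel `Ψ = LagariasMontague.Psi` (the theta series attached to the
polynomial `2X² − 3X`, with `Φ(t) = 2Ψ(2t)` the kernel of Riemann's cosine representation of `Ξ`)
decays faster than every exponential: for every rate `c : ℝ` there is `C` with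
`|Ψ(t)| ≤ C e^{−c|t|}` for all real `t`; consequently `t ↦ Ψ(2t) e^{c|t|}` is integrable on `ℝ`
for every `c`.

**Proof.** The tree's theta-series majorant `|S_p(u)| ≤ C e^{u/4 − (π/4)eᵘ}` on `u ≥ 0`
(`LagariasMontague.exists_abs_thetaSeries_le`) together with evenness `Ψ(|t|) = Ψ(t)`
(`LagariasMontague.Psi_abs`) reduces the decay to the elementary inequality
`x/4 − (π/4)eˣ + c x ≤ (c + 1/4)²` for `x ≥ 0` (from `eˣ ≥ x²/2` and `π ≥ 2`, completing the
square).  Integrability: the integrand is continuous, and by the decay at rate `(c+1)/2` applied at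
`2t` it is dominated by `C e^{−|t|}`, which is integrable (`exp_neg_integrableOn_Ioi` on `(0,∞)`
plus the tree's parity helper `LagariasMontague.integrable_comp_abs`).

Mathlib + `Literature.NumberTheory.LFunctions.RiemannXiFourier` only; no named fact is used; no
definitions.
-/

set_option linter.dupNamespace false

noncomputable section

open MeasureTheory Real Filter Set

namespace Summit.RiemannHypothesis.RiemannHypothesis.Theorems.GroundStatesConvergeToXi

open Literature.NumberTheory.LFunctions

/-- **Elementary majorant bound.** For `x ≥ 0` and every rate `c`,
`e^{x/4 − (π/4)eˣ} ≤ e^{(c + 1/4)²} e^{−c x}`: indeed `eˣ ≥ x²/2` and `π ≥ 2` give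
`(π/4)eˣ ≥ x²/4`, and `(c + 1/4)x − x²/4 ≤ (c + 1/4)²`. [folklore] -/
theorem stub_psiDecay_thetaMajorant_le (c x : ℝ) (hx : 0 ≤ x) :
    LagariasMontague.thetaMajorant x ≤ exp ((c + 1 / 4) ^ 2) * exp (-(c * x)) := by
  rw [LagariasMontague.thetaMajorant, ← exp_add, exp_le_exp]
  have h1 : 1 + x + x ^ 2 / 2 ≤ exp x := Real.quadratic_le_exp_of_nonneg hx
  have h2 : x ^ 2 / 4 ≤ π / 4 * exp x := by
    have h3 : 0 ≤ (π - 2) * exp x := mul_nonneg (by linarith [two_le_pi]) (exp_pos x).le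
    nlinarith
  nlinarith [sq_nonneg (x - 2 * (c + 1 / 4))]

/-- **Super-exponential decay of `Ψ`.** For every `c : ℝ` there is `C` with
`|Ψ(t)| ≤ C e^{−c|t|}` for all real `t`. [folklore] -/
theorem stub_psiDecay_decay (c : ℝ) :
    ∃ C : ℝ, ∀ t : ℝ, |LagariasMontague.Psi t| ≤ C * Real.exp (-(c * |t|)) := by
  obtain ⟨C, hC, hb⟩ := LagariasMontague.exists_abs_thetaSeries_le LagariasMontague.psiPoly 0
  refine ⟨C * exp ((c + 1 / 4) ^ 2), fun t => ?_⟩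
  rw [← LagariasMontague.Psi_abs]
  calc |LagariasMontague.Psi (|t|)| ≤ C * LagariasMontague.thetaMajorant (|t|) :=
        hb (|t|) (by rw [neg_zero]; exact abs_nonneg t)
    _ ≤ C * (exp ((c + 1 / 4) ^ 2) * exp (-(c * |t|))) :=
        mul_le_mul_of_nonneg_left (stub_psiDecay_thetaMajorant_le c (|t|) (abs_nonneg t)) hC
    _ = C * exp ((c + 1 / 4) ^ 2) * exp (-(c * |t|)) := by ring

/-- **All exponential moments of `Ψ(2·)` are finite.** For every `c : ℝ` the function
`t ↦ Ψ(2t) e^{c|t|}` is integrable on `ℝ`. [folklore] -/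
theorem stub_psiDecay_integrable (c : ℝ) :
    Integrable (fun t : ℝ => LagariasMontague.Psi (2 * t) * Real.exp (c * |t|)) := by
  obtain ⟨C, hb⟩ := stub_psiDecay_decay ((c + 1) / 2)
  have hg : Integrable (fun t : ℝ => C * exp (-1 * |t|)) :=
    LagariasMontague.integrable_comp_abs (F := fun u : ℝ => C * exp (-1 * u)) (by fun_prop)
      ((exp_neg_integrableOn_Ioi 0 one_pos).const_mul C)
  have hPsi : Continuous LagariasMontague.Psi := LagariasMontague.continuous_thetaSeries _
  have hcont : Continuous (fun t : ℝ => LagariasMontague.Psi (2 * t) * Real.exp (c * |t|)) :=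
    (hPsi.comp (continuous_const.mul continuous_id)).mul
      (continuous_exp.comp (continuous_const.mul continuous_abs))
  refine hg.mono' hcont.aestronglyMeasurable (ae_of_all _ fun t => ?_)
  rw [Real.norm_eq_abs, abs_mul, abs_of_pos (exp_pos _)]
  have h := hb (2 * t)
  rw [abs_mul, abs_two] at h
  calc |LagariasMontague.Psi (2 * t)| * exp (c * |t|)
      ≤ C * exp (-((c + 1) / 2 * (2 * |t|))) * exp (c * |t|) :=
        mul_le_mul_of_nonneg_right h (exp_pos _).le
    _ = C * exp (-1 * |t|) := by
        rw [mul_assoc, ← exp_add]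
        congr 2
        ring

/-- **Stub `stub_psiDecay` (RH-free).** Riemann's kernel `Ψ = LagariasMontague.Psi` decays
super-exponentially — for every rate `c` there is `C` with `|Ψ(t)| ≤ C e^{-c|t|}` for all real `t`
(theta-series majorant `|S_p(u)| ≤ C e^{u/4 − (π/4)eᵘ}` on `u ≥ 0`, `exists_abs_thetaSeries_le`,
plus evenness `Psi_abs`) — and consequently `t ↦ Ψ(2t) e^{c|t|}` is integrable for every `c`.
[folklore] -/
theorem stub_psiDecay :
    (∀ c : ℝ, ∃ C : ℝ, ∀ t : ℝ, |LagariasMontague.Psi t| ≤ C * Real.exp (-(c * |t|))) ∧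
    (∀ c : ℝ, Integrable (fun t : ℝ => LagariasMontague.Psi (2 * t) * Real.exp (c * |t|))) :=
  ⟨stub_psiDecay_decay, stub_psiDecay_integrable⟩

end Summit.RiemannHypothesis.RiemannHypothesis.Theorems.GroundStatesConvergeToXi

end
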